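import Literature.NumberTheory.Automorphic.LevelActionInducedCoefficients
import Literature.NumberTheory.Automorphic.LevelControlExactSequences
import Mathlib.RepresentationTheory.Homological.GroupCohomology.LowDegree
import HarnessLib

/-!
# Nilpotency of the `U_p`-type operator on `H⁰` of an induced coefficient system

Topic `NumberTheory/Automorphic`; namespace `Literature.NumberTheory.Automorphic.LevelAction`;
theorems only (no new definitions, no named fact, no `sorry`).  Universe `0`.

The degree-zero input of the exact finite-level control (`LevelControlFiniteLevel`, hypotheses
`h₃`, `hC` at `i = 0`): for the induced coefficient system `𝓕(N) = M(U', N ⊗ V)` of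
`LevelActionInducedCoefficients` and the `U_p`-type operator `U` of an adapted family `α_j`,

* **`coe_pow_inducedHecke_apply`** — if every `Γ`-invariant section `F` takes the SAME value at
  `g α_j` for all `j` (`hdet`; for `GL₂` and the unipotent representatives `N(x) t` this is strong
  approximation: `det (g N(x) t)` does not depend on `x`, [cite: Bump1997, Thm. 3.3.1]), then on
  invariant sections `(U^m F)(g) = (1 ⊗ B^m) F(g α_{j₀}^m)` with `B = ∑_j τ(α_j) ∈ End V`;
* **`inducedHeckeCohomology_zero_pow_eq_zero`** — hence `B^n = 0` on `V` implies `U^n = 0` on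
  `H⁰(Γ, 𝓕(N))` (through `groupCohomology.H0Iso` and its naturality), for EVERY `Q`-module `N`.

For trivial coefficients `B = #J · 1 = q_v · 1`, nilpotent modulo `p^c`
([cite: Hida1994AIF, §3, proof of Thm 3.2]: `e` kills `H⁰`); for `Sym^{k-2}` coefficients `B` is
nilpotent modulo `ϖ` because the representatives `(ϖ x; 0 1)` contract `Sym^{k-2}` onto a line on
which `B` acts by `q_v` (`SymPowOrdinaryLine`).

## References

* H. Hida, Ann. Inst. Fourier 44 (1994), §3. [Hida1994AIF]
* C. Khare, J. A. Thorne, Amer. J. Math. 139 (2017), §6.3. [KhareThorne2017]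
* D. Bump, *Automorphic forms and representations* (1997), Thm. 3.3.1. [Bump1997]
-/

noncomputable section

open CategoryTheory groupCohomology
open scoped TensorProduct

namespace Literature.NumberTheory.Automorphic

namespace LevelAction

variable {R : Type} [CommRing R] {Γ 𝒢 : Type} [Group Γ] [Group 𝒢] (ι : Γ →* 𝒢)
  {Δ : Submonoid 𝒢} {V : Type} [AddCommGroup V] [Module R V] (τ : Δ →* Module.End R V)
  {U' : Subgroup 𝒢} (hU' : U'.toSubmonoid ≤ Δ) {Q : Type} [Group Q] (π : U' →* Q)
  {N : Type} [AddCommGroup N] [Module R N] (ρ : Representation R Q N)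
  {J : Type} [Fintype J] {a : J → 𝒢}

omit [Fintype J] in
/-- `(∑_j f_j) ⊗ 1 = ∑_j (f_j ⊗ 1)` (`lTensor` is additive). [folklore] -/
theorem lTensor_sum' (s : Finset J) (f : J → Module.End R V) :
    (∑ j ∈ s, f j).lTensor N = ∑ j ∈ s, (f j).lTensor N := by
  rw [← LinearMap.coe_lTensorHom, map_sum]

/-- **The `U_p`-type operator on a section taking equal values at all `g α_j`**:
`(U F)(g) = (1 ⊗ B) F(g α_{j₀})`, `B = ∑_j τ(α_j)`. [cite: Hida1994AIF, §3] -/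
theorem inducedHeckeFun_apply_of_forall_eq (ha : IsAdaptedFamily Δ U' π a) (j₀ : J)
    (F : 𝒢 → N ⊗[R] V) (g : 𝒢) (hF : ∀ j, F (g * a j) = F (g * a j₀)) :
    inducedHeckeFun τ π ha F g = (∑ j, τ ⟨a j, ha.mem j⟩).lTensor N (F (g * a j₀)) := by
  rw [inducedHeckeFun_apply, lTensor_sum', LinearMap.sum_apply]
  exact Finset.sum_congr rfl fun j _ => by rw [hF j]

/-- **Iterating on `Γ`-invariant sections**: if every `Γ`-invariant section takes equal values at
the `g α_j` (`hdet`), then for a `Γ`-invariant section `F`,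
`(U^m F)(g) = (1 ⊗ B^m) F(g α_{j₀}^m)`. [cite: Hida1994AIF, §3, proof of Thm 3.2] -/
theorem coe_pow_inducedHecke_apply (ha : IsAdaptedFamily Δ U' π a) (j₀ : J)
    (hdet : ∀ F : 𝒢 → N ⊗[R] V, F ∈ sections U'.toSubmonoid (inducedCoeff τ hU' π ρ) U' →
      (∀ γ : Γ, leftTranslation R ι (N ⊗[R] V) γ F = F) → ∀ (g : 𝒢) (j : J), F (g * a j) = F (g * a j₀))
    (m : ℕ) (F : inducedRep ι τ hU' π ρ) (hF : ∀ γ : Γ, (inducedRep ι τ hU' π ρ).ρ γ F = F) (g : 𝒢) :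
    ((((inducedHecke ι τ hU' π ρ ha).hom.toLinearMap ^ m) F :
        sections U'.toSubmonoid (inducedCoeff τ hU' π ρ) U') : 𝒢 → N ⊗[R] V) g =
      ((∑ j, τ ⟨a j, ha.mem j⟩) ^ m).lTensor N ((F : 𝒢 → N ⊗[R] V) (g * a j₀ ^ m)) := by
  induction m generalizing F g with
  | zero =>
    rw [pow_zero, pow_zero, pow_zero, mul_one, Module.End.one_apply, Module.End.one_eq_id,
      LinearMap.lTensor_id, LinearMap.id_apply]
  | succ m ih =>
    have hF' : ∀ γ : Γ, (inducedRep ι τ hU' π ρ).ρ γ ((inducedHecke ι τ hU' π ρ ha).hom.toLinearMap F) =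
        (inducedHecke ι τ hU' π ρ ha).hom.toLinearMap F := fun γ => by
      have h := Rep.hom_comm_apply (inducedHecke ι τ hU' π ρ ha) γ F
      rw [hF γ] at h
      exact h.symm
    have hinv : ∀ γ : Γ, leftTranslation R ι (N ⊗[R] V) γ (F : 𝒢 → N ⊗[R] V) = (F : 𝒢 → N ⊗[R] V) :=
      fun γ => congrArg Subtype.val (hF γ)
    rw [pow_succ, Module.End.mul_apply, ih _ hF' g]
    change ((∑ j, τ ⟨a j, ha.mem j⟩) ^ m).lTensor N
        (inducedHeckeFun τ π ha (F : 𝒢 → N ⊗[R] V) (g * a j₀ ^ m)) = _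
    rw [inducedHeckeFun_apply_of_forall_eq τ π ha j₀ _ _ (hdet _ F.2 hinv (g * a j₀ ^ m)),
      ← LinearMap.comp_apply, ← LinearMap.lTensor_comp, ← Module.End.mul_eq_comp, ← pow_succ,
      mul_assoc, ← pow_succ]

/-- **`H0Iso` transports `U^m` on `H⁰(Γ, 𝓕 N)` to `U^m` on invariant sections** (naturality of
`groupCohomology.H0Iso`). [folklore] -/
theorem coe_H0Iso_hom_inducedHeckeCohomology_pow (ha : IsAdaptedFamily Δ U' π a) (m : ℕ)
    (c : inducedCohomology ι τ hU' π ρ 0) :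
    (((H0Iso (inducedRep ι τ hU' π ρ)).hom ((inducedHeckeCohomology ι τ hU' π ha 0 ^ m) c) :
        (inducedRep ι τ hU' π ρ).ρ.invariants) : inducedRep ι τ hU' π ρ) =
      ((inducedHecke ι τ hU' π ρ ha).hom.toLinearMap ^ m)
        (((H0Iso (inducedRep ι τ hU' π ρ)).hom c : (inducedRep ι τ hU' π ρ).ρ.invariants) :
          inducedRep ι τ hU' π ρ) := by
  induction m generalizing c with
  | zero => rfl
  | succ m ih =>
    rw [pow_succ, Module.End.mul_apply, ih, pow_succ, Module.End.mul_apply]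
    congr 1
    have h := groupCohomology.map_id_comp_H0Iso_hom_apply (inducedHecke ι τ hU' π ρ ha) c
    change (((H0Iso (inducedRep ι τ hU' π ρ)).hom ((inducedHeckeCohomology ι τ hU' π ha 0) c) :
      (inducedRep ι τ hU' π ρ).ρ.invariants) : inducedRep ι τ hU' π ρ) = _
    rw [h]
    rfl

/-- **`B^n = 0` on `V` (and `hdet`) imply `U^n = 0` on `H⁰(Γ, 𝓕 N)`**, for every `Q`-module `N`.
[cite: Hida1994AIF, §3, proof of Thm 3.2] [cite: KhareThorne2017, §6.3] -/
theorem inducedHeckeCohomology_zero_pow_eq_zero (ha : IsAdaptedFamily Δ U' π a) (j₀ : J)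
    (hdet : ∀ F : 𝒢 → N ⊗[R] V, F ∈ sections U'.toSubmonoid (inducedCoeff τ hU' π ρ) U' →
      (∀ γ : Γ, leftTranslation R ι (N ⊗[R] V) γ F = F) → ∀ (g : 𝒢) (j : J), F (g * a j) = F (g * a j₀))
    {n : ℕ} (hB : (∑ j, τ ⟨a j, ha.mem j⟩) ^ n = 0) :
    inducedHeckeCohomology ι τ hU' π ha (ρ := ρ) 0 ^ n = 0 := by
  refine LinearMap.ext fun c => ?_
  have hinj : Function.Injective ((H0Iso (inducedRep ι τ hU' π ρ)).hom :
      inducedCohomology ι τ hU' π ρ 0 → _) := (H0Iso (inducedRep ι τ hU' π ρ)).toLinearEquiv.injective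
  apply hinj
  rw [LinearMap.zero_apply, map_zero]
  apply Subtype.ext
  rw [coe_H0Iso_hom_inducedHeckeCohomology_pow, ZeroMemClass.coe_zero]
  set w := (H0Iso (inducedRep ι τ hU' π ρ)).hom c
  have hw : ∀ γ : Γ, (inducedRep ι τ hU' π ρ).ρ γ (w : inducedRep ι τ hU' π ρ) = w := fun γ => w.2 γ
  refine Subtype.ext (funext fun g => ?_)
  rw [coe_pow_inducedHecke_apply ι τ hU' π ρ ha j₀ hdet n _ hw g, hB, LinearMap.lTensor_zero,
    LinearMap.zero_apply]
  rfl

/-- Pointwise form, as consumed by `LevelControlFiniteLevel` (`h₃`, `hC` with `i = 0`). [folklore] -/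
theorem inducedHeckeCohomology_zero_pow_apply_eq_zero (ha : IsAdaptedFamily Δ U' π a) (j₀ : J)
    (hdet : ∀ F : 𝒢 → N ⊗[R] V, F ∈ sections U'.toSubmonoid (inducedCoeff τ hU' π ρ) U' →
      (∀ γ : Γ, leftTranslation R ι (N ⊗[R] V) γ F = F) → ∀ (g : 𝒢) (j : J), F (g * a j) = F (g * a j₀))
    {n : ℕ} (hB : (∑ j, τ ⟨a j, ha.mem j⟩) ^ n = 0) (c : inducedCohomology ι τ hU' π ρ 0) :
    (inducedHeckeCohomology ι τ hU' π ha 0 ^ n) c = 0 := by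
  rw [inducedHeckeCohomology_zero_pow_eq_zero ι τ hU' π ρ ha j₀ hdet hB, LinearMap.zero_apply]

end LevelAction

end Literature.NumberTheory.Automorphic
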